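import Mathlib.Analysis.SpecialFunctions.Gamma.Digamma
import Mathlib.Analysis.SpecialFunctions.Gamma.Beta
import Mathlib.Analysis.SpecialFunctions.Trigonometric.Complex
import Mathlib.Analysis.SpecialFunctions.Pow.Deriv
import HarnessLib

/-!
# Reflection and duplication formulas for the digamma function; Gauss's values `ψ(1/4)`, `ψ(3/4)`

Trunk T-ANALYSIS support (`Literature/Analysis/SpecialFunctions`). Mathlib (this tree's pin)
defines `Complex.digamma = logDeriv Gamma` and knows `ψ(1) = -γ`, `ψ(1/2) = -γ - 2 log 2` and the
recurrence `ψ(s+1) = ψ(s) + 1/s`, and it has Euler's reflection formula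
`Γ(s)Γ(1-s) = π / sin(πs)` (`Complex.Gamma_mul_Gamma_one_sub`) and Legendre's duplication formula
`Γ(s)Γ(s+1/2) = Γ(2s) 2^{1-2s} √π` (`Complex.Gamma_mul_Gamma_add_half`). Taking logarithmic
derivatives of these two identities (Andrews–Askey–Roy, *Special Functions*, §1.2, (1.2.15) and
the log-derivative of Thm. 1.5.1) gives

* `Literature.Analysis.SpecialFunctions.Complex.digamma_one_sub_sub_digamma` — **reflection**:
  `ψ(1-s) - ψ(s) = π cos(πs)/sin(πs)` for `s ∉ ℤ`;
* `Literature.Analysis.SpecialFunctions.Complex.digamma_add_digamma_add_half` — **duplication**: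
  `ψ(s) + ψ(s + 1/2) = 2ψ(2s) - 2 log 2` for `2s ∉ -ℕ`;
* `Literature.Analysis.SpecialFunctions.Complex.digamma_one_quarter`,
  `Literature.Analysis.SpecialFunctions.Complex.digamma_three_quarters` — **Gauss**:
  `ψ(1/4) = -γ - π/2 - 3 log 2`, `ψ(3/4) = -γ + π/2 - 3 log 2` (the case `p/q = 1/4, 3/4` of
  Gauss's digamma theorem, Andrews–Askey–Roy Thm. 1.2.7), obtained by solving the two linear
  equations given by reflection and duplication at `s = 1/4` together with `ψ(1/2) = -γ - 2 log 2`.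

All statements are proved (no named facts).

## References

* G. E. Andrews, R. Askey, R. Roy, *Special Functions*, Encyclopedia Math. Appl. 71, CUP 1999,
  §1.2 ((1.2.15), Thm. 1.2.7) and §1.5 (Thm. 1.5.1, Legendre duplication). [AndrewsAskeyRoy1999]
-/

noncomputable section

open Complex Filter Topology Set
open scoped Real

namespace Literature.Analysis.SpecialFunctions.Complex

/-! ### Reflection -/

/-- For `s ∉ ℤ`, `s` is not a pole of `Γ`. [folklore] -/
lemma ne_neg_nat_of_forall_ne_int {s : ℂ} (hs : ∀ n : ℤ, s ≠ n) (m : ℕ) : s ≠ -(m : ℂ) := by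
  have := hs (-(m : ℤ))
  push_cast at this
  exact this

/-- For `s ∉ ℤ`, `1 - s` is not a pole of `Γ`. [folklore] -/
lemma one_sub_ne_neg_nat_of_forall_ne_int {s : ℂ} (hs : ∀ n : ℤ, s ≠ n) (m : ℕ) :
    1 - s ≠ -(m : ℂ) := by
  intro h
  have := hs ((m : ℤ) + 1)
  push_cast at this
  exact this (by linear_combination -h)

/-- For `s ∉ ℤ`, `sin(πs) ≠ 0`. [folklore] -/
lemma sin_pi_mul_ne_zero_of_forall_ne_int {s : ℂ} (hs : ∀ n : ℤ, s ≠ n) :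
    Complex.sin (π * s) ≠ 0 := by
  intro h
  obtain ⟨k, hk⟩ := Complex.sin_eq_zero_iff.1 h
  have hπ : (π : ℂ) ≠ 0 := ofReal_ne_zero.2 Real.pi_ne_zero
  exact hs k (mul_left_cancel₀ hπ (by rw [hk]; ring))

/-- **Reflection formula for the digamma function**: `ψ(1-s) - ψ(s) = π cos(πs)/sin(πs) = π cot(πs)`
for `s ∉ ℤ` (logarithmic derivative of Euler's reflection formula `Γ(s)Γ(1-s) = π/sin(πs)`).
[cite: AndrewsAskeyRoy1999, §1.2 (1.2.15) with Thm. 1.2.1] -/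
theorem digamma_one_sub_sub_digamma {s : ℂ} (hs : ∀ n : ℤ, s ≠ n) :
    digamma (1 - s) - digamma s = π * Complex.cos (π * s) / Complex.sin (π * s) := by
  have hΓs : Gamma s ≠ 0 := Complex.Gamma_ne_zero (ne_neg_nat_of_forall_ne_int hs)
  have hΓ1s : Gamma (1 - s) ≠ 0 := Complex.Gamma_ne_zero (one_sub_ne_neg_nat_of_forall_ne_int hs)
  have hdΓs : DifferentiableAt ℂ Gamma s :=
    Complex.differentiableAt_Gamma s (ne_neg_nat_of_forall_ne_int hs)
  have hdΓ1s : DifferentiableAt ℂ Gamma (1 - s) :=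
    Complex.differentiableAt_Gamma (1 - s) (one_sub_ne_neg_nat_of_forall_ne_int hs)
  have hsin : Complex.sin (π * s) ≠ 0 := sin_pi_mul_ne_zero_of_forall_ne_int hs
  have hπ : (π : ℂ) ≠ 0 := ofReal_ne_zero.2 Real.pi_ne_zero
  -- the identity of functions and its logarithmic derivative at `s`
  have hfun : (fun z : ℂ ↦ Gamma z * Gamma (1 - z)) = fun z ↦ (π : ℂ) / Complex.sin (π * z) :=
    funext Complex.Gamma_mul_Gamma_one_sub
  have hlog := congrArg (fun f : ℂ → ℂ ↦ logDeriv f s) hfun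
  -- left-hand side
  have hcomp : DifferentiableAt ℂ (fun z : ℂ ↦ Gamma (1 - z)) s := by
    have : (fun z : ℂ ↦ Gamma (1 - z)) = Gamma ∘ fun z : ℂ ↦ 1 - z := rfl
    rw [this]
    exact hdΓ1s.comp s (by fun_prop)
  have hL : logDeriv (fun z : ℂ ↦ Gamma z * Gamma (1 - z)) s = digamma s - digamma (1 - s) := by
    rw [logDeriv_mul (f := Gamma) (g := fun z : ℂ ↦ Gamma (1 - z)) s hΓs hΓ1s hdΓs hcomp]
    have h2 : logDeriv (fun z : ℂ ↦ Gamma (1 - z)) s = -digamma (1 - s) := by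
      have : (fun z : ℂ ↦ Gamma (1 - z)) = Gamma ∘ fun z : ℂ ↦ 1 - z := rfl
      rw [this, logDeriv_comp (f := Gamma) (g := fun z : ℂ ↦ 1 - z) (x := s) hdΓ1s (by fun_prop),
        Complex.digamma_def]
      have hd : deriv (fun z : ℂ ↦ 1 - z) s = -1 := by
        rw [deriv_const_sub, deriv_id'']
      rw [hd]
      ring
    rw [h2, Complex.digamma_def]
    ring
  -- right-hand side
  have hR : logDeriv (fun z : ℂ ↦ (π : ℂ) / Complex.sin (π * z)) s =
      -(π * Complex.cos (π * s) / Complex.sin (π * s)) := by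
    have hds : HasDerivAt (fun z : ℂ ↦ Complex.sin (π * z)) (Complex.cos (π * s) * π) s := by
      have h1 : HasDerivAt (fun z : ℂ ↦ (π : ℂ) * z) (π : ℂ) s := by
        simpa using (hasDerivAt_id s).const_mul (π : ℂ)
      exact (Complex.hasDerivAt_sin (π * s)).comp s h1
    rw [logDeriv_div (f := fun _ : ℂ ↦ (π : ℂ)) (g := fun z : ℂ ↦ Complex.sin (π * z)) s hπ hsin
      (differentiableAt_const _) hds.differentiableAt, logDeriv_const, Pi.zero_apply, zero_sub,
      logDeriv_apply, hds.deriv]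
    ring
  rw [hL, hR] at hlog
  linear_combination -hlog

/-! ### Duplication -/

/-- **Duplication formula for the digamma function**: `ψ(s) + ψ(s + 1/2) = 2ψ(2s) - 2 log 2`
whenever `2s ∉ -ℕ` (logarithmic derivative of Legendre's duplication formula
`Γ(s)Γ(s+1/2) = 2^{1-2s} √π Γ(2s)`). [cite: AndrewsAskeyRoy1999, §1.5 Thm. 1.5.1 (log-derivative)] -/
theorem digamma_add_digamma_add_half {s : ℂ} (hs : ∀ m : ℕ, 2 * s ≠ -(m : ℂ)) :
    digamma s + digamma (s + 1 / 2) = 2 * digamma (2 * s) - 2 * Complex.log 2 := by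
  -- `s`, `s + 1/2`, `2s` are not poles
  have hs₁ : ∀ m : ℕ, s ≠ -(m : ℂ) := by
    intro m h
    exact hs (2 * m) (by rw [h]; push_cast; ring)
  have hs₂ : ∀ m : ℕ, s + 1 / 2 ≠ -(m : ℂ) := by
    intro m h
    exact hs (2 * m + 1) (by push_cast; linear_combination 2 * h)
  have hΓs : Gamma s ≠ 0 := Complex.Gamma_ne_zero hs₁
  have hΓs₂ : Gamma (s + 1 / 2) ≠ 0 := Complex.Gamma_ne_zero hs₂
  have hΓ2s : Gamma (2 * s) ≠ 0 := Complex.Gamma_ne_zero hs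
  have hdΓs : DifferentiableAt ℂ Gamma s := Complex.differentiableAt_Gamma s hs₁
  have hdΓs₂ : DifferentiableAt ℂ Gamma (s + 1 / 2) := Complex.differentiableAt_Gamma _ hs₂
  have hdΓ2s : DifferentiableAt ℂ Gamma (2 * s) := Complex.differentiableAt_Gamma _ hs
  have h2 : (2 : ℂ) ≠ 0 := two_ne_zero
  have hsqrtπ : ((√Real.pi : ℝ) : ℂ) ≠ 0 :=
    ofReal_ne_zero.2 (Real.sqrt_ne_zero'.2 Real.pi_pos)
  have hpow : (2 : ℂ) ^ (1 - 2 * s) ≠ 0 := by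
    rw [Ne, cpow_eq_zero_iff]
    exact fun h ↦ h2 h.1
  -- the identity of functions and its logarithmic derivative at `s`
  have hfun : (fun z : ℂ ↦ Gamma z * Gamma (z + 1 / 2)) =
      fun z ↦ Gamma (2 * z) * (2 : ℂ) ^ (1 - 2 * z) * ((√Real.pi : ℝ) : ℂ) :=
    funext Complex.Gamma_mul_Gamma_add_half
  have hlog := congrArg (fun f : ℂ → ℂ ↦ logDeriv f s) hfun
  -- left-hand side
  have hcomp₂ : DifferentiableAt ℂ (fun z : ℂ ↦ Gamma (z + 1 / 2)) s := by
    have : (fun z : ℂ ↦ Gamma (z + 1 / 2)) = Gamma ∘ fun z : ℂ ↦ z + 1 / 2 := rfl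
    rw [this]
    exact hdΓs₂.comp s (by fun_prop)
  have hL : logDeriv (fun z : ℂ ↦ Gamma z * Gamma (z + 1 / 2)) s =
      digamma s + digamma (s + 1 / 2) := by
    rw [logDeriv_mul (f := Gamma) (g := fun z : ℂ ↦ Gamma (z + 1 / 2)) s hΓs hΓs₂ hdΓs hcomp₂]
    have h2' : logDeriv (fun z : ℂ ↦ Gamma (z + 1 / 2)) s = digamma (s + 1 / 2) := by
      have : (fun z : ℂ ↦ Gamma (z + 1 / 2)) = Gamma ∘ fun z : ℂ ↦ z + 1 / 2 := rfl
      rw [this, logDeriv_comp (f := Gamma) (g := fun z : ℂ ↦ z + 1 / 2) (x := s) hdΓs₂ (by fun_prop),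
        Complex.digamma_def]
      have hd : deriv (fun z : ℂ ↦ z + 1 / 2) s = 1 := by
        rw [deriv_add_const, deriv_id'']
      rw [hd, mul_one]
    rw [h2', Complex.digamma_def]
  -- right-hand side, factor by factor
  have hcomp2 : DifferentiableAt ℂ (fun z : ℂ ↦ Gamma (2 * z)) s := by
    have : (fun z : ℂ ↦ Gamma (2 * z)) = Gamma ∘ fun z : ℂ ↦ 2 * z := rfl
    rw [this]
    exact hdΓ2s.comp s (by fun_prop)
  have hA : logDeriv (fun z : ℂ ↦ Gamma (2 * z)) s = 2 * digamma (2 * s) := by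
    have : (fun z : ℂ ↦ Gamma (2 * z)) = Gamma ∘ fun z : ℂ ↦ 2 * z := rfl
    rw [this, logDeriv_comp (f := Gamma) (g := fun z : ℂ ↦ 2 * z) (x := s) hdΓ2s (by fun_prop),
      Complex.digamma_def]
    have hd : deriv (fun z : ℂ ↦ 2 * z) s = 2 := by
      rw [deriv_const_mul _ differentiableAt_id, deriv_id'', mul_one]
    rw [hd, mul_comm]
  have hdpow : HasDerivAt (fun z : ℂ ↦ (2 : ℂ) ^ (1 - 2 * z))
      ((2 : ℂ) ^ (1 - 2 * s) * Complex.log 2 * (-2)) s := by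
    have hlin : HasDerivAt (fun z : ℂ ↦ 1 - 2 * z) (-2) s := by
      simpa using ((hasDerivAt_id s).const_mul (2 : ℂ)).const_sub 1
    exact hlin.const_cpow (Or.inl h2)
  have hB : logDeriv (fun z : ℂ ↦ (2 : ℂ) ^ (1 - 2 * z)) s = -2 * Complex.log 2 := by
    rw [logDeriv_apply, hdpow.deriv]
    field_simp
  have hAB : logDeriv (fun z : ℂ ↦ Gamma (2 * z) * (2 : ℂ) ^ (1 - 2 * z)) s =
      2 * digamma (2 * s) - 2 * Complex.log 2 := by
    rw [logDeriv_mul (f := fun z : ℂ ↦ Gamma (2 * z)) (g := fun z : ℂ ↦ (2 : ℂ) ^ (1 - 2 * z)) s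
      hΓ2s hpow hcomp2 hdpow.differentiableAt, hA, hB]
    ring
  have hR : logDeriv (fun z : ℂ ↦ Gamma (2 * z) * (2 : ℂ) ^ (1 - 2 * z) * ((√Real.pi : ℝ) : ℂ)) s
      = 2 * digamma (2 * s) - 2 * Complex.log 2 := by
    rw [logDeriv_mul_const (f := fun z : ℂ ↦ Gamma (2 * z) * (2 : ℂ) ^ (1 - 2 * z)) s _ hsqrtπ,
      hAB]
  rw [hL, hR] at hlog
  exact hlog

/-! ### Gauss's values at `1/4` and `3/4` -/

/-- `1/4 ∉ ℤ`. [folklore] -/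
lemma one_quarter_ne_int (n : ℤ) : (1 / 4 : ℂ) ≠ n := by
  intro h
  have h' := congrArg Complex.re h
  simp only [div_ofNat_re, one_re, intCast_re] at h'
  have h4 : (1 : ℝ) = 4 * (n : ℝ) := by linarith
  have : (1 : ℤ) = 4 * n := by exact_mod_cast h4
  omega

/-- Reflection at `1/4`: `ψ(3/4) - ψ(1/4) = π`. [cite: AndrewsAskeyRoy1999, §1.2 (1.2.15)] -/
theorem digamma_three_quarters_sub_digamma_one_quarter :
    digamma (3 / 4) - digamma (1 / 4) = π := by
  have h := digamma_one_sub_sub_digamma (s := 1 / 4) one_quarter_ne_int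
  have h34 : (1 : ℂ) - 1 / 4 = 3 / 4 := by norm_num
  have harg : (π : ℂ) * (1 / 4) = ((Real.pi / 4 : ℝ) : ℂ) := by push_cast; ring
  rw [h34, harg, ← Complex.ofReal_cos, ← Complex.ofReal_sin, Real.cos_pi_div_four,
    Real.sin_pi_div_four] at h
  rw [h]
  have hsqrt : ((√2 / 2 : ℝ) : ℂ) ≠ 0 := ofReal_ne_zero.2 (by positivity)
  field_simp

/-- Duplication at `1/4`: `ψ(1/4) + ψ(3/4) = -2γ - 6 log 2` (using `ψ(1/2) = -γ - 2 log 2`).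
[cite: AndrewsAskeyRoy1999, §1.5 Thm. 1.5.1 (log-derivative) and §1.2 Thm. 1.2.7] -/
theorem digamma_one_quarter_add_digamma_three_quarters :
    digamma (1 / 4) + digamma (3 / 4) =
      -2 * (Real.eulerMascheroniConstant : ℂ) - 6 * Complex.log 2 := by
  have hs : ∀ m : ℕ, 2 * (1 / 4 : ℂ) ≠ -(m : ℂ) := by
    intro m h
    have h' := congrArg Complex.re h
    simp only [mul_re, re_ofNat, div_ofNat_re, one_re, im_ofNat, div_ofNat_im, one_im,
      zero_div, mul_zero, sub_zero, neg_re, natCast_re] at h'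
    have : (0 : ℝ) ≤ m := Nat.cast_nonneg m
    linarith
  have h := digamma_add_digamma_add_half hs
  have h1 : (1 / 4 : ℂ) + 1 / 2 = 3 / 4 := by norm_num
  have h2 : 2 * (1 / 4 : ℂ) = 1 / 2 := by norm_num
  rw [h1, h2, Complex.digamma_one_half] at h
  rw [h]
  ring

/-- **Gauss's digamma value `ψ(1/4) = -γ - π/2 - 3 log 2`.**
[cite: AndrewsAskeyRoy1999, §1.2 Thm. 1.2.7 (p/q = 1/4)] -/
theorem digamma_one_quarter :
    digamma (1 / 4) = -(Real.eulerMascheroniConstant : ℂ) - π / 2 - 3 * Complex.log 2 := by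
  have h1 := digamma_three_quarters_sub_digamma_one_quarter
  have h2 := digamma_one_quarter_add_digamma_three_quarters
  linear_combination (h2 - h1) / 2

/-- **Gauss's digamma value `ψ(3/4) = -γ + π/2 - 3 log 2`.**
[cite: AndrewsAskeyRoy1999, §1.2 Thm. 1.2.7 (p/q = 3/4)] -/
theorem digamma_three_quarters :
    digamma (3 / 4) = -(Real.eulerMascheroniConstant : ℂ) + π / 2 - 3 * Complex.log 2 := by
  have h1 := digamma_three_quarters_sub_digamma_one_quarter
  have h2 := digamma_one_quarter_add_digamma_three_quarters
  linear_combination (h2 + h1) / 2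

/-- Real-cast form of Gauss's value: `ψ(1/4) = -(γ + π/2 + 3 log 2)` with the real constant
`γ + π/2 + 3 log 2` (the form in which it enters Suzuki's screw function `Ψ` of `ζ`,
`Literature.NumberTheory.LFunctions.zetaScrew`). [cite: AndrewsAskeyRoy1999, §1.2 Thm. 1.2.7] -/
theorem digamma_one_quarter_eq_neg_ofReal :
    digamma (1 / 4) =
      -((Real.eulerMascheroniConstant + Real.pi / 2 + 3 * Real.log 2 : ℝ) : ℂ) := by
  rw [digamma_one_quarter]
  push_cast
  rw [Complex.ofReal_log zero_le_two]
  push_cast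
  ring

end Literature.Analysis.SpecialFunctions.Complex
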